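import Mathlib
import Literature.Analysis.ODE.InfallLagComparison
import Literature.Geometry.Lorentzian.ReggeWheelerTortoise
import Summits.FinalStateConjecture.FinalStateConjecture.Theorems.PhotonSphereChannelsWindowedShellChannelsLagLawPotential
import Summits.FinalStateConjecture.FinalStateConjecture.Theorems.PhotonSphereChannelsWindowedShellChannelsLagLawUniformBeam

/-!
# `WindowedShellChannels` (stmt-FinalStateConjecture-14085), the lag laws — VI: the near-side law
# `h ≥ 4M log 2`

Support file (prover seat 1; everything proved, no definitions). Write `Inner_W(M, ρ, h, c)` for the
body of `Theses.PhotonSphereChannels.WindowedShellChannels` after `∃ h ≥ 0, ∃ c > 0`. The main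
theorem (`stub_lagLawNear`, registered) is the **near-side lag law**

  `∀ M > 0, ∀ ρ > 0, ∀ h, ∀ c > 0, Inner_W(M, ρ, h, c) → 4 M log 2 ≤ h`,

the standing adversary's near-miss `lag_ge_four_mul_log_two` (`Cruxes/WindowedShellChannels/
Disproof.lean`, sorried there: "needs exact Klein–Gordon/Rindler rest packets for times `≍ M`").
It complements the small-`ρ` logarithmic law of `…LagLaw.lean` by a bound valid for EVERY `ρ`:
a high-frequency rest packet flush below the near edge `xc − ρ` falls into the horizon lagging
`4M log 2·(1 − o(1))` (and more) behind the light ray from its starting point, so it is caught by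
neither lagged channel unless `h ≥ 4M log 2`.

Proof. Along the tortoise line the `s = 1` profile `q = (1 − 2M/r)/r²` satisfies
`q′ ≤ q/(2M)` everywhere (`deriv_photonQ_le`), whence `q(x) ≥ q(x₀)e^{−(x₀−x)/(2M)}` below any
launch point (`photonQ_exp_comparison`), and `q′ > 0` on the near side. The infall comparison
`Literature.Analysis.ODE.infall_lag_ge` (surface gravity `κ = 1/(4M)`) gives, for the Hamiltonian
ray released at rest at `x₀ = xc − ρ − δ₀`, a time `T` with retarded lag `≥ 4M log 2 − ε`; the cut
Gaussian rest beam along this ray (`LagLaw.beam_package_uniform`) then sits inside the lagged ball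
at time `T` when `h < 4M log 2 − 2ε`, and `LagLaw.packet_contradiction` finishes.
-/

noncomputable section

-- every `Summit.FinalStateConjecture.FinalStateConjecture.…` name repeats the summit = sub-problem
-- segment (D-0017 layout), as in every landed `…Theorems` file of this route
set_option linter.dupNamespace false

namespace Summit.FinalStateConjecture.FinalStateConjecture.Theorems.LagLaw

open Literature.Geometry.Lorentzian Literature.Geometry.Lorentzian.ReggeWheeler
open Literature.Analysis.ODE
open Summit.FinalStateConjecture.FinalStateConjecture.Theorems
open MeasureTheory Set Filter Topology Function
open scoped ENNReal NNReal

/-! ### Near-side facts on `q = (1 − 2M/r)/r²` -/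

section Potential

variable {M : ℝ} {r : ℝ → ℝ} {xc : ℝ}

/-- `q′ > 0` strictly inside the photon sphere (`x < xc`, i.e. `r < 3M`). -/
theorem deriv_photonQ_pos_of_lt (hr : IsTortoiseRadius M r xc) {x : ℝ} (hx : x < xc) :
    0 < deriv (fun x => (1 - 2 * M / r x) / r x ^ 2) x := by
  rw [deriv_photonQ_eq hr]
  have h3 : r x < 3 * M := by rw [← hr.center]; exact hr.strictMono hx
  have hf : 0 < 1 - 2 * M / r x := hr.deriv_pos x
  have hr0 : 0 < r x := hr.pos x
  have : 0 < 2 * (3 * M - r x) / r x ^ 4 := by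
    apply div_pos (by linarith) (by positivity)
  positivity

/-- **`q′ ≤ q/(2M)` everywhere** (equivalently `(log q)′ ≤ 1/(2M) = 2κ`, `κ = 1/(4M)` the surface
gravity): `q′ = (1 − 2M/r)·2(3M − r)/r⁴ ≤ (1 − 2M/r)/(2Mr²)` iff `4M(3M − r) ≤ r²` iff
`0 ≤ (r − 2M)(r + 6M)`. -/
theorem deriv_photonQ_le (hr : IsTortoiseRadius M r xc) (x : ℝ) :
    deriv (fun x => (1 - 2 * M / r x) / r x ^ 2) x ≤ (1 - 2 * M / r x) / r x ^ 2 / (2 * M) := by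
  rw [deriv_photonQ_eq hr]
  have hM : 0 < M := hr.mass_pos
  have hf : 0 < 1 - 2 * M / r x := hr.deriv_pos x
  have hr0 : 0 < r x := hr.pos x
  have h2 : 2 * M < r x := hr.two_mul_lt x
  rw [← sub_nonneg]
  have e : (1 - 2 * M / r x) / r x ^ 2 / (2 * M) - 2 * (3 * M - r x) / r x ^ 4 * (1 - 2 * M / r x)
      = (1 - 2 * M / r x) * ((r x - 2 * M) * (r x + 6 * M)) / (2 * M * r x ^ 4) := by
    field_simp
    ring
  rw [e]
  apply div_nonneg _ (by positivity)
  apply mul_nonneg hf.le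
  nlinarith

/-- **Exponential comparison below a launch point**: `q(x) ≥ q(x₀) e^{−2κ(x₀ − x)}` for `x ≤ x₀`,
`κ = 1/(4M)` (the function `log q(y) − y/(2M)` is non-increasing by `deriv_photonQ_le`). -/
theorem photonQ_exp_comparison (hr : IsTortoiseRadius M r xc) {x x₀ : ℝ} (hx : x ≤ x₀) :
    (1 - 2 * M / r x₀) / r x₀ ^ 2 * Real.exp (-(2 * (1 / (4 * M)) * (x₀ - x)))
      ≤ (1 - 2 * M / r x) / r x ^ 2 := by
  have hM : 0 < M := hr.mass_pos
  have hqpos := photonQ_pos hr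
  have hqd : Differentiable ℝ fun x => (1 - 2 * M / r x) / r x ^ 2 :=
    (contDiff_photonQ hr 1).differentiable one_ne_zero
  -- `φ(y) = log q(y) − y/(2M)` is non-increasing
  have hφ : ∀ y, HasDerivAt (fun y => Real.log ((1 - 2 * M / r y) / r y ^ 2) - y / (2 * M))
      (deriv (fun x => (1 - 2 * M / r x) / r x ^ 2) y / ((1 - 2 * M / r y) / r y ^ 2)
        - 1 / (2 * M)) y := by
    intro y
    have h1 := ((hqd y).hasDerivAt).log (hqpos y).ne'
    have h2 : HasDerivAt (fun y : ℝ => y / (2 * M)) (1 / (2 * M)) y := (hasDerivAt_id y).div_const _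
    exact h1.sub h2
  have hanti : Antitone fun y => Real.log ((1 - 2 * M / r y) / r y ^ 2) - y / (2 * M) := by
    refine antitone_of_deriv_nonpos (fun y => (hφ y).differentiableAt) fun y => ?_
    rw [(hφ y).deriv, sub_nonpos, div_le_iff₀ (hqpos y), one_div, inv_mul_eq_div]
    exact deriv_photonQ_le hr y
  have h := hanti hx
  simp only at h
  -- exponentiate
  have e : -(2 * (1 / (4 * M)) * (x₀ - x)) = -((x₀ - x) / (2 * M)) := by field_simp; ring
  rw [e]
  calc (1 - 2 * M / r x₀) / r x₀ ^ 2 * Real.exp (-((x₀ - x) / (2 * M)))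
      = Real.exp (Real.log ((1 - 2 * M / r x₀) / r x₀ ^ 2) - x₀ / (2 * M) + x / (2 * M)) := by
        rw [show Real.log ((1 - 2 * M / r x₀) / r x₀ ^ 2) - x₀ / (2 * M) + x / (2 * M)
          = Real.log ((1 - 2 * M / r x₀) / r x₀ ^ 2) + -((x₀ - x) / (2 * M)) by ring,
          Real.exp_add, Real.exp_log (hqpos x₀)]
    _ ≤ Real.exp (Real.log ((1 - 2 * M / r x) / r x ^ 2) - x / (2 * M) + x / (2 * M)) :=
        Real.exp_le_exp.2 (by linarith)
    _ = (1 - 2 * M / r x) / r x ^ 2 := by rw [sub_add_cancel, Real.exp_log (hqpos x)]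

end Potential

/-! ### The near-side law for an abstract profile -/

/-- **The near-side lag law, abstract form.** `q` is a smooth positive bounded profile with
Lipschitz `q′`, `q′ ≥ 0` on `(−∞, 0]`, `q′ > 0` on `(−∞, 0)`, dominating exponentials of rate `2κ`
below every launch point `x₀ ≤ 0`; the potentials are `ℓ(ℓ+1)q`, the shell is `{|x| ≤ ρ}`. Then the
body of the crux at `(ρ, h, c)` forces `(log 2)/κ ≤ h`. -/
theorem lagLawNear_core {q : ℝ → ℝ} {Cq κ : ℝ} (hκ : 0 < κ)
    (hq : ∀ n : ℕ∞, ContDiff ℝ n q) {K : ℝ≥0} (hK : LipschitzWith K (deriv q))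
    (hqpos : ∀ x, 0 < q x) (hqb : ∀ x, |q x| ≤ Cq)
    (hq' : ∀ x, x ≤ 0 → 0 ≤ deriv q x) (hq'' : ∀ x, x < 0 → 0 < deriv q x)
    (hcmp : ∀ x₀, x₀ ≤ 0 → ∀ x, x ≤ x₀ → q x₀ * Real.exp (-(2 * κ * (x₀ - x))) ≤ q x)
    {ρ h c : ℝ} (hρ : 0 < ρ) (hc : 0 < c)
    (hInner : ∀ ℓ : ℕ, 1 ≤ ℓ → ∀ ψ : ℝ → ℝ → ℝ,
        IsSolution (fun x => ((ℓ : ℝ) * ((ℓ : ℝ) + 1)) * q x) ψ →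
        CauchyDataSupportedOn ψ {x : ℝ | ρ < |x - 0|} →
        ENNReal.ofReal c * totalEnergy (fun x => ((ℓ : ℝ) * ((ℓ : ℝ) + 1)) * q x) ψ 0
          ≤ channelEnergy (fun x => ((ℓ : ℝ) * ((ℓ : ℝ) + 1)) * q x) 0 (ρ - h) ψ atTop
            + channelEnergy (fun x => ((ℓ : ℝ) * ((ℓ : ℝ) + 1)) * q x) 0 (ρ - h) ψ atBot) :
    Real.log 2 / κ ≤ h := by
  by_contra hcon
  rw [not_le] at hcon
  /- (1) margins: `h = log 2/κ − 4ε`, cut-off radius `δ₀ = min ρ ε`, launch point `x₀ = −ρ − δ₀` -/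
  obtain ⟨ε, hε⟩ : ∃ ε : ℝ, ε = (Real.log 2 / κ - h) / 4 := ⟨_, rfl⟩
  have hε0 : 0 < ε := by rw [hε]; linarith
  obtain ⟨δ₀, hδ₀⟩ : ∃ δ₀ : ℝ, δ₀ = min ρ ε := ⟨_, rfl⟩
  have hδ₀0 : 0 < δ₀ := by rw [hδ₀]; exact lt_min hρ hε0
  have hδ₀ρ : δ₀ ≤ ρ := by rw [hδ₀]; exact min_le_left _ _
  have hδ₀ε : δ₀ ≤ ε := by rw [hδ₀]; exact min_le_right _ _
  obtain ⟨x₀, hx₀⟩ : ∃ x₀ : ℝ, x₀ = -ρ - δ₀ := ⟨_, rfl⟩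
  have hx₀0 : x₀ < 0 := by rw [hx₀]; linarith
  /- (2) the beam family along the infalling ray, and the infall time -/
  obtain ⟨X, ξ, hX0, hξ0, hX2, hXH, hξH, hXlip, hBT⟩ :=
    beam_package_uniform (hq 3) hK hqpos x₀ hδ₀0
  have hω₀ : 0 < Real.sqrt (q x₀) := Real.sqrt_pos.2 (hqpos _)
  have hω₀sq : Real.sqrt (q x₀) ^ 2 = q x₀ := Real.sq_sqrt (hqpos _).le
  obtain ⟨hXle, hlag⟩ := infall_lag_ge (xc := 0) hω₀ hω₀sq hκ (hq 2) hXH hξH hX0 hξ0 hx₀0 hq'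
    (hq'' x₀ hx₀0) (hcmp x₀ hx₀0.le)
  obtain ⟨T, hT0, hTlag⟩ := hlag ε hε0
  obtain ⟨B, -, hBμ⟩ := hBT T
  have hXT : X T ≤ x₀ := hXle T hT0.le
  /- (3) geometry: the datum is off the shell, the slab at time `T` is inside the lagged ball -/
  have hslab : ∀ x, |x| ≤ ρ → δ₀ ≤ |x - x₀| := by
    intro x hx
    have : -ρ ≤ x := by linarith [neg_abs_le x]
    rw [abs_of_nonneg (by linarith)]
    linarith
  have ha : 0 ≤ ρ - h + T := by linarith
  have hball : ∀ x, ρ - h + |T| < |x - 0| → δ₀ < |x - X T| := by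
    intro x hx
    rw [sub_zero, abs_of_pos hT0] at hx
    rcases le_or_gt 0 x with hx0 | hx0
    · rw [abs_of_nonneg hx0] at hx
      rw [abs_of_pos (by linarith)]
      linarith
    · rw [abs_of_neg hx0] at hx
      rw [abs_of_neg (by linarith)]
      linarith
  exact packet_contradiction hq hqpos hqb hc hδ₀0 hT0 ha hX0 hX2.continuous hXlip hBμ hslab hball
    hInner

/-! ### The Regge–Wheeler law -/

/-- **Registered sub-goal `stub_lagLawNear` of stmt-FinalStateConjecture-14085 — the near-side
lag law `h ≥ 4M log 2`.** For every `M > 0`, every `ρ > 0`, every lag `h` and rate `c > 0` for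
which the body of `Theses.PhotonSphereChannels.WindowedShellChannels` holds, `4 M log 2 ≤ h`.
See the module docstring for the proof. -/
theorem stub_lagLawNear : ∀ M : ℝ, 0 < M → ∀ ρ : ℝ, 0 < ρ → ∀ h c : ℝ, 0 < c → (∀ (r : ℝ → ℝ) (xc : ℝ), IsTortoiseRadius M r xc → ∀ (s ℓ : ℕ), s ≤ 2 → s ≤ ℓ → ∀ ψ : ℝ → ℝ → ℝ, IsRWSolution M s ℓ r ψ → CauchyDataSupportedOn ψ {x : ℝ | ρ < |x - xc|} → ENNReal.ofReal c * totalEnergy (linePotential M s ℓ r) ψ 0 ≤ channelEnergy (linePotential M s ℓ r) xc (ρ - h) ψ Filter.atTop + channelEnergy (linePotential M s ℓ r) xc (ρ - h) ψ Filter.atBot) → 4 * M * Real.log 2 ≤ h := by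
  intro M hM ρ hρ h c hc hInner
  obtain ⟨r, hr⟩ := exists_isTortoiseRadius hM 0
  have hqb : ∀ x, |(1 - 2 * M / r x) / r x ^ 2| ≤ 1 / (4 * M ^ 2) := fun x => by
    rw [abs_of_pos (photonQ_pos hr x)]; exact photonQ_le hr x
  have hκ : 0 < 1 / (4 * M) := by positivity
  have hlaw := lagLawNear_core (q := fun x => (1 - 2 * M / r x) / r x ^ 2) (κ := 1 / (4 * M)) hκ
    (contDiff_photonQ hr) (lipschitzWith_deriv_photonQ hr) (photonQ_pos hr) hqb
    (fun x hx => deriv_photonQ_nonneg hr hx) (fun x hx => deriv_photonQ_pos_of_lt hr hx)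
    (fun x₀ _ x hx => photonQ_exp_comparison hr hx) (h := h) hρ hc ?_
  · have e : Real.log 2 / (1 / (4 * M)) = 4 * M * Real.log 2 := by field_simp
    rw [e] at hlaw
    exact hlaw
  · intro ℓ hℓ ψ hψ hdata
    have hψ' : IsRWSolution M 1 ℓ r ψ := by
      show IsSolution (linePotential M 1 ℓ r) ψ
      rw [linePotential_one_eq]
      exact hψ
    have hI := hInner r 0 hr 1 ℓ (by norm_num) hℓ ψ hψ' hdata
    rw [linePotential_one_eq] at hI
    exact hI

end Summit.FinalStateConjecture.FinalStateConjecture.Theorems.LagLaw
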